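import Mathlib
import HarnessLib
import Summits.NavierStokesRegularity.NavierStokesRegularity.Theorems.TaylorModelRungThreeReadoutVNodes
import Summits.NavierStokesRegularity.NavierStokesRegularity.Theorems.TaylorModelRungThreeReadoutVTubeDeriv

/-!
# Line `taylor-model` on crux K1b-DR (stmt-NavierStokesRegularity-23954) — G1-v (derivative part): the STAGE MAP is
# differentiable within the polytope, with kernel in the certified derivative enclosure `DerivEncl`

For a v3 certificate and flow package, the window-coordinate stage map to node `s`,
`Φ_s x := toVec (φ(ofVec x)(Tn s))`, is differentiable WITHIN the polytope image `W_j := toVec '' InPoly j` at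
every polytope point, and the kernel of its derivative composed with the stage scaling `Dsc j` satisfies
`DerivEncl cd rd j s` (engine-1 g67's `derivEncl_step` discharges the algebra; the analysis is the chain rule with
the sub-step derivative of (F9), `exists_stepKer_of_core`, whose kernel lies in `[Mlo, Mhi]`).  This is the input
of the landing read-out (G4-v: (R10) pushes the kernel through the last in-step kernel, the Poincaré-map theorem
of `Literature.Analysis.ODE.PoincareSection` corrects for the crossing time, (R11) bounds the faces).

* `eq_sum_basisSt_of_wsupp`, `kapp_kerOf` — a window-supported state in the window basis; `kapp (kerOf L) v = L v`
  for linear `L` with window-supported values;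
* `stageMap_congr` — `Φ_s (toVec q) = toVec (φ(q)(Tn s))`;
* `polyDerivV` — the induction: `∃ L K, HasFDerivWithinAt Φ_s L (toVec '' InPoly j) (toVec q) ∧ DerivEncl j s K ∧ L ∘ toVec ∘ Dsc = kapp K`
  on window rows.

MODEL-lattice rung TL-M3 only; nothing here is a statement about the Navier–Stokes equations.
-/

noncomputable section

-- the sub-problem namespace repeats the summit name by design (D-0017)
set_option linter.dupNamespace false

namespace Summit.NavierStokesRegularity.NavierStokesRegularity.Theorems.TaylorModelV

open Set Finset
open Literature.Analysis.FluidPDE.TaoCascade Literature.Analysis.FluidPDE.TaoCascade.TaylorChain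
open Summit.NavierStokesRegularity.NavierStokesRegularity.Theorems.TaylorModelMajorant
open Summit.NavierStokesRegularity.NavierStokesRegularity.Theorems.TaylorModelReadout

variable {cd : CertData} {bx : StepBoxes} {rd : RadiiData} {φ : Flow}

/-! ### Window basis, `kerOf`, the polytope in window coordinates -/

/-- A window-supported state in the window basis: `v = Σ_c (toVec v c) • basisSt (modeOf c) (shellOf c)`. [folklore] -/
theorem eq_sum_basisSt_of_wsupp {v : Fin 4 → ℤ → ℝ} (hv : cd.Wsupp v) :
    v = ∑ c : Fin (nW cd), toVec cd v c • basisSt (modeOf cd c) (shellOf cd c) := by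
  funext i k
  rw [Finset.sum_apply, Finset.sum_apply]
  by_cases hk : -cd.Kb ≤ k ∧ k ≤ cd.Ka
  · rw [Finset.sum_eq_single (eW cd (i, ⟨k, Finset.mem_Icc.2 hk⟩))]
    · simp [toVec, basisSt, modeOf, shellOf]
    · intro c _ hc
      have hne : ¬ (i = modeOf cd c ∧ k = shellOf cd c) := by
        rintro ⟨h1, h2⟩
        subst h1 h2
        exact hc (eW_modeOf_shellOf c).symm
      simp [basisSt, hne]
    · intro h; exact absurd (Finset.mem_univ _) h
  · rw [hv i k hk]
    symm
    refine Finset.sum_eq_zero fun c _ => ?_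
    have hne : ¬ (i = modeOf cd c ∧ k = shellOf cd c) := by
      rintro ⟨-, h2⟩; exact hk (h2 ▸ shellOf_mem cd c)
    simp [basisSt, hne]

/-- `kapp (kerOf L) v = L v` on window rows, for a linear `L` and window-supported `v`. [folklore] -/
theorem kapp_kerOf {L : (Fin 4 → ℤ → ℝ) → (Fin 4 → ℤ → ℝ)} (hL : IsLinearMap ℝ L) {v : Fin 4 → ℤ → ℝ}
    (hv : cd.Wsupp v) (i' : Fin 4) {k' : ℤ} (hk' : -cd.Kb ≤ k' ∧ k' ≤ cd.Ka) :
    kapp cd (kerOf L) v i' k' = L v i' k' := by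
  rw [kapp_apply_of_InW _ v i' hk']
  have hsum : L (∑ c : Fin (nW cd), toVec cd v c • basisSt (modeOf cd c) (shellOf cd c)) =
      ∑ c : Fin (nW cd), L (toVec cd v c • basisSt (modeOf cd c) (shellOf cd c)) := map_sum hL.mk' _ _
  conv_rhs => rw [eq_sum_basisSt_of_wsupp hv, hsum]
  rw [Finset.sum_apply, Finset.sum_apply]
  refine Finset.sum_congr rfl fun c _ => ?_
  rw [hL.map_smul]
  simp only [kerOf, Pi.smul_apply, smul_eq_mul]
  ring

/-! ### The stage map -/

section Stage

variable (hC : ChainVCore cd bx) (hR : ChainVRadii cd bx rd) (hF : IsFlowPackageV cd bx φ) {j : ℕ} (hj : j ≤ cd.N₀)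
include hC hR hF hj

/-- The stage map at a polytope point read through `ofVec ∘ toVec`: `Φ_s (toVec q) = toVec (φ(q)(Tn s))` for
`s ≤ S`. [folklore] -/
theorem stageMap_congr {s : ℕ} (hs : s ≤ cd.S j) {q : Fin 4 → ℤ → ℝ} (hq : InPoly cd j q) :
    toVec cd (stAt φ j (ofVec cd (toVec cd q)) (cd.Tn j s)) = toVec cd (stAt φ j q (cd.Tn j s)) := by
  have hU := isUniqueFlow_of_packageV hF
  have hsol := ((polyInvariantV hC hR hF).1 j hj q hq).1
  have hT : 0 ≤ cd.Tn j (cd.S j) := (gridV hC hj).2.2.2 _ le_rfl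
  have h := (solvesOn_congr_windowU hU hj hT hsol (z' := ofVec cd (toVec cd q)) fun i k hk1 hk2 => by
    rw [ofVec_toVec, trunc_apply, if_pos ⟨hk1, hk2⟩]).2 (cd.Tn j s)
    ⟨(gridV hC hj).2.2.2 _ hs, (gridV hC hj).2.2.1 _ le_rfl _ hs⟩
  rw [h]

/-- **G1-v, derivative part.** For every node `s ≤ S` and polytope point `q`: the stage map `Φ_s` is
differentiable within the polytope image `toVec '' InPoly j` at `toVec q` with some derivative `L`, and some kernel `K ∈ DerivEncl cd rd j s`
represents `L ∘ toVec ∘ Dsc` on window rows: `L (toVec (Dsc v)) (eW (i′,k′)) = kapp K v i′ k′` for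
window-supported `v`. [folklore] -/
theorem polyDerivV (hSN : cd.StageNumerics) :
    ∀ s, s ≤ cd.S j → ∀ q, InPoly cd j q →
      ∃ (L : (Fin (nW cd) → ℝ) →L[ℝ] (Fin (nW cd) → ℝ)) (K : Ker),
        HasFDerivWithinAt (fun x => toVec cd (stAt φ j (ofVec cd x) (cd.Tn j s))) L (toVec cd '' {q | InPoly cd j q}) (toVec cd q) ∧
        DerivEncl cd rd j s K ∧
        ∀ v, cd.Wsupp v → ∀ i' k' (hk' : -cd.Kb ≤ k' ∧ k' ≤ cd.Ka),
          L (toVec cd (rd.Dsc j v)) (eW cd (i', ⟨k', Finset.mem_Icc.2 hk'⟩)) = kapp cd K v i' k' := by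
  have hU := isUniqueFlow_of_packageV hF
  obtain ⟨hDlin, hDws, -, -, hVc0, hZ0, -, -⟩ := hR j hj
  have hPI := (polyInvariantV hC hR hF).1 j hj
  intro s
  induction s with
  | zero =>
    intro _ q hq
    -- `Φ_0 = id` on the polytope image
    have hid : ∀ x ∈ toVec cd '' {q | InPoly cd j q}, toVec cd (stAt φ j (ofVec cd x) (cd.Tn j 0)) = x := by
      rintro x ⟨q', hq', rfl⟩
      rw [stageMap_congr hC hR hF hj (Nat.zero_le _) hq', (gridV hC hj).1]
      funext c
      exact ((hPI q' hq').1 (modeOf cd c) (shellOf cd c) (shellOf_mem cd c).1 (shellOf_mem cd c).2).1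
    refine ⟨ContinuousLinearMap.id ℝ _, kerOf (rd.Dsc j), ?_, ?_, ?_⟩
    · exact ((ContinuousLinearMap.id ℝ _).hasFDerivAt.hasFDerivWithinAt).congr hid (hid _ (Set.mem_image_of_mem (toVec cd) hq))
    · refine ⟨fun _ _ _ _ => 0, hZ0, fun v hv => ?_⟩
      have h0 : kapp cd (fun _ _ _ _ => (0:ℝ)) v = 0 := by
        funext i' k'
        by_cases hk' : -cd.Kb ≤ k' ∧ k' ≤ cd.Ka
        · rw [kapp_apply_of_InW _ v i' hk']; simp
        · exact kapp_off _ v i' hk'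
      obtain ⟨-, -, hlinCm, -⟩ := (hC j hj).2.2.1 0 (Nat.zero_le _)
      rw [h0, hlinCm.map_zero, add_zero, hVc0]
      exact eq_of_wsupp_of_window (wsupp_kapp _ _) (hDws v) fun i' k' hk1 hk2 =>
        kapp_kerOf hDlin hv i' ⟨hk1, hk2⟩
    · intro v hv i' k' hk'
      rw [ContinuousLinearMap.id_apply, kapp_kerOf hDlin hv i' hk']
      simp [toVec, modeOf, shellOf]
  | succ s IH =>
    intro hs1 q hq
    have hs : s < cd.S j := Nat.lt_of_succ_le hs1
    obtain ⟨L, K, hL, hK, hLK⟩ := IH hs.le q hq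
    -- the node state and the sub-step derivative of (F9) there
    have hn2 : InBox cd (bx.hlo 2 j s) (bx.hhi 2 j s) (stAt φ j q (cd.Tn j s)) :=
      inBox_hull2_of_hull1 hC hj hs.le ((hPI q hq).2 s hs.le)
    obtain ⟨L', K', hL', -, hK'M, hLK'⟩ := exists_stepKer_of_core hSN hC hj hs hn2
    -- chain rule within the polytope image
    have hmaps : MapsTo (fun x => toVec cd (stAt φ j (ofVec cd x) (cd.Tn j s))) (toVec cd '' {q | InPoly cd j q})
        (Icc (toVec cd (bx.hlo 2 j s)) (toVec cd (bx.hhi 2 j s))) := by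
      rintro x ⟨q', hq', rfl⟩
      show toVec cd (stAt φ j (ofVec cd (toVec cd q')) (cd.Tn j s)) ∈ _
      rw [stageMap_congr hC hR hF hj hs.le hq']
      exact toVec_mem_Icc_of_bounds (cd := cd) (inBox_hull2_of_hull1 hC hj hs.le ((hPI q' hq').2 s hs.le))
    have hat : toVec cd (stAt φ j (ofVec cd (toVec cd q)) (cd.Tn j s)) = toVec cd (stAt φ j q (cd.Tn j s)) :=
      stageMap_congr hC hR hF hj hs.le hq
    rw [← hat] at hL'
    have hcomp := hL'.comp (toVec cd q) hL hmaps
    -- `Φ_{s+1} = flowSel(·, h s) ∘ Φ_s` on the polytope image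
    have hTs := ((gridV hC hj).2.1 s hs).2
    have hstep : ∀ x ∈ toVec cd '' {q | InPoly cd j q}, toVec cd (stAt φ j (ofVec cd x) (cd.Tn j (s + 1))) =
        flowSel (Qw cd) (toVec cd (stAt φ j (ofVec cd x) (cd.Tn j s))) (cd.h j s) := by
      rintro x ⟨q', hq', rfl⟩
      rw [stageMap_congr hC hR hF hj hs1 hq', stageMap_congr hC hR hF hj hs.le hq', ← toVec_stAt_eq_flowSel hF]
      have h1 := (stAt_shiftU hU hj (hPI q' hq').1 (t := cd.Tn j s)
        ⟨(gridV hC hj).2.2.2 _ hs.le, (gridV hC hj).2.2.1 _ le_rfl _ hs.le⟩).2 (cd.Tn j (s + 1))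
        ⟨(gridV hC hj).2.2.1 _ hs1 _ (Nat.le_succ s), (gridV hC hj).2.2.1 _ le_rfl _ hs1⟩
      rw [h1, hTs, add_sub_cancel_left]
    refine ⟨L'.comp L, kcomp cd K' K, hcomp.congr hstep (hstep _ (Set.mem_image_of_mem (toVec cd) hq)), derivEncl_step hR hj hs hK'M hK,
      fun v hv i' k' hk' => ?_⟩
    rw [ContinuousLinearMap.comp_apply, hLK' _ i' k' hk', kapp_kcomp]
    have hc := kapp_congr (cd := cd) K' (v := ofVec cd (L (toVec cd (rd.Dsc j v)))) (w := kapp cd K v)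
      fun i k hk1 hk2 => by rw [ofVec_apply_of_mem cd _ i ⟨hk1, hk2⟩]; exact hLK v hv i k ⟨hk1, hk2⟩
    rw [hc]

end Stage

end Summit.NavierStokesRegularity.NavierStokesRegularity.Theorems.TaylorModelV

end
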